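import Summits.QuantumFields.YangMills.Theorems.BalabanUVNodesN06SectBKnitWindow
import Literature.MathematicalPhysics.QuantumFieldTheory.Balaban1983to89.B9Eq3132TentBumps

/-!
# Balaban UV-stability nodes, N06 [B9] — «KE₆X-WINDOW»: THE JOINT x-FREE KNIT-CLUSTER WINDOW OF THE KNIT CERTIFICATE «KE₆X» IS NON-EMPTY (A6)

[B9] = T. Bałaban, *Propagators for lattice gauge theories in a background field*, Commun. Math. Phys. **99** (1985) 389–434
[`Balaban1985BackgroundPropagators`]; [4] = *Propagators and renormalization transformations II* [`Balaban1984PropagatorsII`];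
[Av] = *Averaging operations for lattice gauge theories*, Commun. Math. Phys. **98** (1985) 17–51 [`Balaban1985Averaging`].

Track A of `YM-PLAN.md` (cell `pub-ymgap`), node **N06**, acceleration seat `pub-ymgap-dag-n06-d` (g27), for the dag-lead's A6 audit of the N06 knit head
`N06AtOpsYSectEStKnitRecordKE6X.b9LeafXUR_opsYSectESt_knitRecord_KE6X` (✓p805384).  That certificate displays ONE knit smallness parameter `α₀ᴷ` (with the
plaquette cap `aᴷ` and the two complex-level radii `ϱ′`, `ϱ`) under TWENTY-FOUR x-free numeric side conditions collected from five suppliers: KA's knit-letter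
window (`C₀α₀ᴷ ≦ 1∕3`, `2α₀ᴷ ≦ c₂′`, `K_pl(a)L⁴ < α₀ᴷ` for `a ≦ aᴷ`), node00-def-Y's guard adapters (`4α₀ᴷ ≦ c₂′`, `exp(4·800(d+2)²(d+5)α₀ᴷ) < 2`,
`k_col·α₀ᴷ < 1`), dag-n06-c's coded Sect.-B step (`8α₀ᴷ ≦ c₂′`, the two `N`-windows, [Av] Prop. 5's complex-level windows in `ϱ′`, `ϱ`), dag-n06-l's row-26
test family (`(α₀ᴷm₀)²·2Nb₁·2(d+1)C_Θ ≦ b₀∕256`) and (3.46) leg (`(d+1)²α₀ᴷ ≦ 1∕100`), and [B9] (3.16)'s `α₀ᴷ ≦ α_Q`.  Each supplier proved ITS OWN window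
non-empty (`knitWindow_inhabited_le`, `knitSectBWindow_inhabited_le∕_N`, `knitTestWindow_inhabited_le`), each choosing its own `α₀′`.  THIS FILE proves the
conjunction for ONE COMMON tuple `(α₀ᴷ, aᴷ, ϱ′, ϱ)`, below any cap `amax > 0` (so that the couplings `p.a₁∕c ≦ aᴷ`, `a₁₂ ≦ aᴷ`, `a_inv ≦ aᴷ` of the certificate are
met by choosing the primed constants AFTER `aᴷ`): `knitClusterWindow_inhabited_KE6X`.  Proof: dag-n06-c's `knitSectBWindow_inhabited_le` at the cap
`min(amax, 1∕(k_col+1), 1∕(100(d+1)²), 1∕(8(N+1)W), 1, b₀∕(256(K+1)))` (`W := 32(d+2)(d+5)L²`, `K := m₀²·2Nb₁·2(d+1)C_Θ`), then elementary monotonicity — the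
`N`-windows as in dag-n06-c's `knitSectBWindow_inhabited_N`, the test-family smallness as in dag-n06-l's `knitTestWindow_inhabited_le`.
Every conjunct is spelled VERBATIM as the corresponding displayed hypothesis of «KE₆X» with `θ.d₆ θ.ℓ₆ N θ.b₀ θ.b₁ ↦ d ℓ N b₀ b₁`.

HONEST FRAMING: elementary real arithmetic over landed window lemmas; an A6 (non-vacuity) certificate for x-free numeric displays, NOT a discharge of any
row of the certificate; COUNT-NEUTRAL; N06 NOT discharged; nothing continuum ∕ OS ∕ mass gap ∕ Clay.  0 `def`, 0 `sorry`.
[cite: Balaban1985BackgroundPropagators, p.409 («α₀ so small …»), (3.16) p.393, (3.35)–(3.36) p.396, (3.132) p.422; Balaban1985Averaging, Prop. 2 p.26,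
Prop. 5 p.42, Prop. 7 p.43, (147) p.40; Balaban1984PropagatorsII, (2.147) p.248, (2.16) p.225]
-/

noncomputable section

namespace Summit.QuantumFields.YangMills.BalabanUVNodes.N06KnitClusterWindowKE6X

open Literature.MathematicalPhysics.QuantumFieldTheory.Balaban1983to89
open Literature.MathematicalPhysics.QuantumFieldTheory.Balaban1983to89.B6KLevelCensusIndexV1 (KIdx kGeo)
open Literature.MathematicalPhysics.QuantumFieldTheory.Balaban1983to89.B7Prop2Explicit (C0 c2' c2'_pos)
open Literature.MathematicalPhysics.QuantumFieldTheory.Balaban1983to89.B7Prop3Flat (c3 c3_pos)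
open Literature.MathematicalPhysics.QuantumFieldTheory.Balaban1983to89.B7Prop5CplxLevels (epsCplx tauCplx)
open Literature.MathematicalPhysics.QuantumFieldTheory.Balaban1983to89.B9Eq316AveragingTransposeZd (alphaQ)
open Literature.MathematicalPhysics.QuantumFieldTheory.Balaban1983to89.B9C2FormBoxRegimeY (Kpl)
open Literature.MathematicalPhysics.QuantumFieldTheory.Balaban1983to89.B9Eq3115KnitLetterYOnto (kCol kCol_nonneg)
open Literature.MathematicalPhysics.QuantumFieldTheory.Balaban1983to89.B9Eq3132TentBumps (Cth)
open Summit.QuantumFields.YangMills.BalabanUVNodes.N06SectBKnitWindow (knitSectBWindow_inhabited_le)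

/-- ★ **THE JOINT KNIT-CLUSTER WINDOW OF «KE₆X», INHABITED** (x-free, A6): for `0 < b₀`, `0 ≤ b₁` and any cap `amax > 0` there is ONE tuple `(α₀ᴷ, aᴷ, ϱ′, ϱ)` with
`0 < α₀ᴷ ≤ amax`, `0 < aᴷ`, `0 < ϱ′`, `0 < ϱ` satisfying SIMULTANEOUSLY the twenty-four x-free knit-cluster displays of
`N06AtOpsYSectEStKnitRecordKE6X.b9LeafXUR_opsYSectESt_knitRecord_KE6X` (in its spelling, `θ.d₆ θ.ℓ₆ θ.b₀ θ.b₁ ↦ d ℓ b₀ b₁`): `hαK3 hαK2 hαK4 hα8 hαQK hexpK hsmallK hKplK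
hαdK hα4N hαπN hsmall' hc₃' hϱ'1 hEc hdX hsmall hc₃ hT16`.  Proof: `N06SectBKnitWindow.knitSectBWindow_inhabited_le` below the cap
`min (amax, 1∕(k_col+1), 1∕(100(d+1)²), 1∕(8(N+1)·32(d+2)(d+5)L²), 1, b₀∕(256(K+1)))`, then monotonicity.
[cite: Balaban1985BackgroundPropagators, p.409, (3.16) p.393, (3.35)–(3.36) p.396; Balaban1985Averaging, Prop. 5 p.42, Prop. 7 p.43; Balaban1984PropagatorsII, (2.147) p.248] -/
theorem knitClusterWindow_inhabited_KE6X (d ℓ N : ℕ) {b₀ b₁ amax : ℝ} (hb₀ : 0 < b₀) (hb₁ : 0 ≤ b₁) (hamax : 0 < amax) :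
    ∃ α₀K aK ϱ' ϱ : ℝ,
      0 < α₀K ∧ α₀K ≤ amax ∧ 0 < aK ∧ 0 < ϱ' ∧ 0 < ϱ ∧
      -- KA's knit-letter window, node00-def-Y's guard adapters, dag-n06-c's `8α₀ᴷ ≤ c₂′`, [B9] (3.16)'s `α₀ᴷ ≤ α_Q`
      C0 (d + 1) * α₀K ≤ 1 / 3 ∧ 2 * α₀K ≤ c2' (d + 1) (ℓ + 1) ∧ 4 * α₀K ≤ c2' (d + 1) (ℓ + 1) ∧ 8 * α₀K ≤ c2' (d + 1) (ℓ + 1) ∧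
      α₀K ≤ alphaQ (d + 1) (ℓ + 1) ∧
      Real.exp (4 * (800 * (((d + 1 : ℕ) : ℝ) + 1) ^ 2 * (((d + 1 : ℕ) : ℝ) + 4)) * α₀K) < 2 ∧
      kCol (d + 1) (ℓ + 1) * α₀K < 1 ∧
      (∀ {hd : 1 ≤ d + 1} {hL : Odd (ℓ + 1) ∧ 1 < ℓ + 1} {b₀' b₁' : ℝ} (i : KIdx d ℓ hd hL b₀' b₁') (a : ℝ), 0 ≤ a → a ≤ aK →
        Kpl i a * (kGeo i).L ^ 4 < α₀K) ∧
      -- dag-n06-l's (3.46)-leg floor `hαdK`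
      ((d : ℝ) + 1) ^ 2 * α₀K ≤ 1 / 100 ∧
      -- dag-n06-c's two `N`-windows `hα4N hαπN`
      32 * (((d + 1 : ℕ) : ℝ) + 1) * ((d + 1 : ℕ) + 4) * (((ℓ + 1 : ℕ) : ℝ)) ^ 2 * α₀K ≤ 1 / 4 ∧
      (N : ℝ) * (32 * (((d + 1 : ℕ) : ℝ) + 1) * ((d + 1 : ℕ) + 4) * (((ℓ + 1 : ℕ) : ℝ)) ^ 2 * α₀K) < Real.pi ∧
      -- dag-n06-c's [Av] Prop. 5 complex-level windows `hsmall' hc₃' hϱ'1 hEc hdX hsmall hc₃`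
      Real.exp (4 * (800 * ((((d + 1 : ℕ) : ℝ)) + 1) ^ 2 * ((((d + 1 : ℕ) : ℝ)) + 4)) * α₀K) * (1 + 8 * (131072 * ((((d + 1 : ℕ) : ℝ)) + 1) ^ 2) * ϱ') ≤ 2 ∧
      2 * ϱ' ≤ c3 (d + 1) (ℓ + 1) ∧
      409600 * ((((d + 1 : ℕ) : ℝ)) + 1) ^ 2 * ϱ' ≤ 1 ∧
      epsCplx (d + 1) (ℓ + 1) ϱ' 0 ≤ 1 / 16 ∧
      (((d + 1 : ℕ) : ℝ)) * (epsCplx (d + 1) (ℓ + 1) ϱ' 0 + tauCplx (d + 1) (ℓ + 1) α₀K 0 ϱ' 0) ≤ 1 / 16 ∧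
      Real.exp (4480 * ((((d + 1 : ℕ) : ℝ)) + 1) ^ 2 * ((((d + 1 : ℕ) : ℝ)) + 4) * α₀K + 240000 * ((((d + 1 : ℕ) : ℝ)) + 1) ^ 3 * ϱ') *
          (1 + 8 * (2097152 * ((((d + 1 : ℕ) : ℝ)) + 1) ^ 2) * ϱ) ≤ 2 ∧
      2 * ϱ ≤ c3 (d + 1) (ℓ + 1) / 4 ∧
      -- dag-n06-l's row-26 test-family smallness `hT16`
      (α₀K * (2 * ((d : ℝ) + 1) * kCol (d + 1) (ℓ + 1) + 8 * ((d : ℝ) + 2) ^ 2)) ^ 2 * (2 * (N : ℝ) * b₁) * (2 * ((d : ℝ) + 1) * Cth d) ≤ b₀ / 256 := by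
  -- the constants of the caps
  set W : ℝ := 32 * (((d + 1 : ℕ) : ℝ) + 1) * ((d + 1 : ℕ) + 4) * (((ℓ + 1 : ℕ) : ℝ)) ^ 2 with hW
  set K : ℝ := (2 * ((d : ℝ) + 1) * kCol (d + 1) (ℓ + 1) + 8 * ((d : ℝ) + 2) ^ 2) ^ 2 * (2 * (N : ℝ) * b₁) * (2 * ((d : ℝ) + 1) * Cth d) with hK
  have hk := kCol_nonneg (d + 1) (ℓ + 1)
  have hK0 : 0 ≤ K := by rw [hK]; unfold Cth; positivity
  have hWpos : 0 < W := by rw [hW]; positivity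
  have hN1 : (0 : ℝ) < (N : ℝ) + 1 := by positivity
  have hkc1 : 0 < kCol (d + 1) (ℓ + 1) + 1 := by linarith
  have hd2 : (0 : ℝ) < ((d : ℝ) + 1) ^ 2 := by positivity
  have hK1 : 0 < K + 1 := by linarith
  set a' : ℝ := min amax (min (1 / (kCol (d + 1) (ℓ + 1) + 1)) (min (1 / (100 * ((d : ℝ) + 1) ^ 2)) (min (1 / (8 * ((N : ℝ) + 1) * W))
    (min 1 (b₀ / (256 * (K + 1))))))) with ha'
  have ha'pos : 0 < a' :=
    lt_min hamax (lt_min (by positivity) (lt_min (by positivity) (lt_min (by positivity) (lt_min one_pos (by positivity)))))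
  obtain ⟨α₀K, aK, ϱ', ϱ, hα0, hαle, hαQ, hα3, hα4, hα8, haK, hKpl, hϱ'0, hsmall', hc₃', hϱ'1, hEc, hdX, -, hϱ0, hsmall, hc₃⟩ :=
    knitSectBWindow_inhabited_le d ℓ ha'pos
  -- the six caps
  have hαamax : α₀K ≤ amax := hαle.trans (min_le_left _ _)
  have hαkc : α₀K ≤ 1 / (kCol (d + 1) (ℓ + 1) + 1) := hαle.trans ((min_le_right _ _).trans (min_le_left _ _))
  have hαd : α₀K ≤ 1 / (100 * ((d : ℝ) + 1) ^ 2) := hαle.trans ((min_le_right _ _).trans ((min_le_right _ _).trans (min_le_left _ _)))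
  have hαA : α₀K ≤ 1 / (8 * ((N : ℝ) + 1) * W) :=
    hαle.trans ((min_le_right _ _).trans ((min_le_right _ _).trans ((min_le_right _ _).trans (min_le_left _ _))))
  have hα1 : α₀K ≤ 1 :=
    hαle.trans ((min_le_right _ _).trans ((min_le_right _ _).trans ((min_le_right _ _).trans ((min_le_right _ _).trans (min_le_left _ _)))))
  have hαb : α₀K ≤ b₀ / (256 * (K + 1)) :=
    hαle.trans ((min_le_right _ _).trans ((min_le_right _ _).trans ((min_le_right _ _).trans ((min_le_right _ _).trans (min_le_right _ _)))))
  -- `W·α₀ᴷ ≤ 1∕(8(N+1))`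
  have hWα : W * α₀K ≤ 1 / (8 * ((N : ℝ) + 1)) := by
    calc W * α₀K ≤ W * (1 / (8 * ((N : ℝ) + 1) * W)) := mul_le_mul_of_nonneg_left hαA hWpos.le
      _ = 1 / (8 * ((N : ℝ) + 1)) := by field_simp
  refine ⟨α₀K, aK, ϱ', ϱ, hα0, hαamax, haK, hϱ'0, hϱ0, hα3, by linarith, hα4, hα8, hαQ, ?_, ?_, fun i a ha hale => hKpl i a ha hale, ?_, ?_, ?_,
    hsmall', hc₃', hϱ'1, hEc, hdX, hsmall, hc₃, ?_⟩
  · -- `exp(…α₀ᴷ) < 2` from `hsmall'` (the second factor exceeds `1`)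
    have hE := Real.exp_pos (4 * (800 * ((((d + 1 : ℕ) : ℝ)) + 1) ^ 2 * ((((d + 1 : ℕ) : ℝ)) + 4)) * α₀K)
    have hx : 0 < 8 * (131072 * ((((d + 1 : ℕ) : ℝ)) + 1) ^ 2) * ϱ' := by positivity
    have h1 : Real.exp (4 * (800 * ((((d + 1 : ℕ) : ℝ)) + 1) ^ 2 * ((((d + 1 : ℕ) : ℝ)) + 4)) * α₀K) * 1 <
        Real.exp (4 * (800 * ((((d + 1 : ℕ) : ℝ)) + 1) ^ 2 * ((((d + 1 : ℕ) : ℝ)) + 4)) * α₀K) * (1 + 8 * (131072 * ((((d + 1 : ℕ) : ℝ)) + 1) ^ 2) * ϱ') :=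
      mul_lt_mul_of_pos_left (by linarith) hE
    rw [mul_one] at h1
    exact lt_of_lt_of_le h1 hsmall'
  · -- `k_col·α₀ᴷ < 1`
    have h1 : kCol (d + 1) (ℓ + 1) * α₀K ≤ kCol (d + 1) (ℓ + 1) * (1 / (kCol (d + 1) (ℓ + 1) + 1)) := mul_le_mul_of_nonneg_left hαkc hk
    have h2 : kCol (d + 1) (ℓ + 1) * (1 / (kCol (d + 1) (ℓ + 1) + 1)) < 1 := by
      rw [mul_one_div, div_lt_one hkc1]; linarith
    linarith
  · -- `(d+1)²α₀ᴷ ≤ 1∕100`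
    calc ((d : ℝ) + 1) ^ 2 * α₀K ≤ ((d : ℝ) + 1) ^ 2 * (1 / (100 * ((d : ℝ) + 1) ^ 2)) := mul_le_mul_of_nonneg_left hαd hd2.le
      _ = 1 / 100 := by field_simp
  · -- `W·α₀ᴷ ≤ 1∕4`
    have h3 : 1 / (8 * ((N : ℝ) + 1)) ≤ 1 / 4 := by
      have hN0 : (0 : ℝ) ≤ (N : ℝ) := Nat.cast_nonneg N
      rw [div_le_div_iff₀ (by positivity) (by norm_num)]; linarith
    exact hWα.trans h3
  · -- `N·W·α₀ᴷ ≤ N∕(8(N+1)) < 1 < π`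
    have h1 : (N : ℝ) * (W * α₀K) ≤ (N : ℝ) * (1 / (8 * ((N : ℝ) + 1))) := mul_le_mul_of_nonneg_left hWα (Nat.cast_nonneg N)
    have h2 : (N : ℝ) * (1 / (8 * ((N : ℝ) + 1))) < 1 := by
      have hN0 : (0 : ℝ) ≤ (N : ℝ) := Nat.cast_nonneg N
      rw [mul_one_div, div_lt_one (by positivity)]; linarith
    have h3 : (1 : ℝ) < Real.pi := by linarith [Real.pi_gt_three]
    linarith
  · -- `(α₀ᴷm₀)²·2Nb₁·2(d+1)C_Θ = α₀ᴷ·(α₀ᴷ·K) ≤ 1·(b₀∕256)`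
    have e : (α₀K * (2 * ((d : ℝ) + 1) * kCol (d + 1) (ℓ + 1) + 8 * ((d : ℝ) + 2) ^ 2)) ^ 2 * (2 * (N : ℝ) * b₁) * (2 * ((d : ℝ) + 1) * Cth d) =
        α₀K * (α₀K * K) := by
      rw [hK]; ring
    rw [e]
    have hαK : α₀K * K ≤ b₀ / 256 := by
      calc α₀K * K ≤ b₀ / (256 * (K + 1)) * K := mul_le_mul_of_nonneg_right hαb hK0
        _ ≤ b₀ / (256 * (K + 1)) * (K + 1) := mul_le_mul_of_nonneg_left (by linarith) (div_nonneg hb₀.le (by positivity))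
        _ = b₀ / 256 := by field_simp
    calc α₀K * (α₀K * K) ≤ 1 * (α₀K * K) := mul_le_mul_of_nonneg_right hα1 (mul_nonneg hα0.le hK0)
      _ ≤ b₀ / 256 := by rw [one_mul]; exact hαK

end Summit.QuantumFields.YangMills.BalabanUVNodes.N06KnitClusterWindowKE6X

end
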